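import Literature.MathematicalPhysics.QuantumFieldTheory.Balaban1983to89.B9Eq3130HessianSlotPerturbationDiagonal
import Literature.MathematicalPhysics.QuantumFieldTheory.Balaban1983to89.B7Eq43AveragedSmallnessLinearFeed

/-!
# `Balaban1983to89.B9Eq3130HessianSlotPerturbationTwoWindows` — T. Bałaban, *Propagators for lattice gauge theories in a background field*, Commun. Math. Phys.
# **99** (1985) 389–434 [Balaban1985BackgroundPropagators] (3.130) p. 421 *«G = G₀(I − Δ′_πG₀)⁻¹»* with (3.120) p. 419, (3.122) p. 420, Thm 3.11 p. 416 and the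
# small-field class (3.35) p. 396, ON PRINT's DIAGONAL `ηL^{n+1} = 1`: **THE HESSIAN-SLOT PERTURBATION OF THE `k`-TH-STEP OPERATOR ON PRINT's CLASS (3.35) —
# NO PROFILE BINDER** — the row OWNER t4-ne9-p1 g87's `B9Eq3130HessianSlotPerturbationDiagonal.exists_hessian_slot_perturbation_diagonal` (abstract in the
# slot `Δ₁`, form letter `θ` displayed) with the level-profile binders `εU ∕ hεU ∕ hUε ∕ hεg ∕ r ∕ hUb` STRUCK by this lineage's α-LINEAR two-window feed
# `B7Eq43AveragedSmallnessLinearFeed.twoWindows_linear_feed`: the background valued in an averaging-closed `S ≤ U1`, bonds `αη`-close, plaquettes `αη²`-close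

statement-level skeleton of published theorems with citation tags; proofs where landed; nothing here is a claim about the Yang–Mills mass gap

CITATION HEADER (lean-in-tree rule).  Audit cell `pub-balaban`, sub-cell `t4`, BINDER row NE9; filed by NE9 crux-team (2) leaf prover 03
(`b2b-balaban-t4-ne9-formalise-leaf-03`, gen 67), INTENT I-ne9leaf03-g67-A (journal [NE9LEAF03-G67-ONLINE]); host = the row OWNER's plan v7 «the Δ_π port»
steps (iii) + (iv-G) (`g87/DELTA-PI-PROGRAMME.md`).  Sources READ in the held text `paper:balaban1985-cmp99-background-propagators` (journal page = PDF page + 388)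
pp. 396, 416, 419–421.  Objects BY NAME: the owner's `laplaceAk`, `QkW`, `RofUk`, `hessOp`; lit-balaban's `laplaceALatticeK`, `greenK`, `covCurlL2K`, `covDivL2K`;
nothing re-declared, 0 `def`.

THE PRINT (verbatim).  p. 420: *«It differs from the operator investigated in previous sections by the additional term Δ′_π, but we will prove that this
term is a small perturbation of Δ_a, and that the operator G used in the above formula has all the properties formulated in Theorems 3.3, 3.10, 3.11»*;
p. 421: *«Let us denote for a moment the operator we have investigated in previous sections by G₀, i.e. G₀ = (Δ + DRD* + Q*aQ)⁻¹. From (3.120) we get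
G = G₀(I − Δ′_πG₀)⁻¹ (3.130)»*; p. 396: the small-field class (3.35) — bonds `αη`-close, plaquettes `αη²`-close; (3.37) for the averaged configurations
is a consequence ([Balaban1985Averaging] Prop. 2).

WHY THIS FILE (cell context).  The host states (3.130) in the energy currency, abstract in the Hessian slot, on the owner's DIAGONAL binder class, which
carries the level profile `‖Ū^j(b) − 1‖ ≤ ε_j ≤ αr^j` of the averaged backgrounds and `U(b) ∈ U1` as HYPOTHESES.  On print's class (3.35) these are
CONSEQUENCES: [Balaban1985Averaging] Prop. 2 iterated (`B7Eq43AveragedSmallnessLevelFree`) — packaged α-LINEARLY by this lineage's `twoWindows_linear_feed`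
(class parameter `Kα`, `K = 1 + 512(d+1)(d+4)`, profile `ε_j ≤ Kα(1∕L)^j`).  Since the host's three conclusions do not mention `α`, the re-issue only
shrinks the threshold: `α₀ := T(α₀^{host})`, `γ₁` and the constants `γ₁∕2`, `2∕γ₁²` UNCHANGED.  With the OWNER's θ-letter for `Δ₁ := π_k†Δ^ηπ_k`
(INTENT-7 `B9Eq3120DeltaPiPrimeFormDiagonal`, `θ = θ̄α`) this is print's passage `G₀ ↦ G̃` on the class (3.35) itself.

WHAT IS PROVED (sorry-free; proof lane — 0 `def`; [folklore] binder plumbing over landed files).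
* **`exists_hessian_slot_perturbation_twoWindows`** — `∃ α₀ γ₁ > 0` (`γ₁` = the host's `γ(d,a)∕4`; `α₀` closed in `(d, a, L, M_φ, M_φ′, C_τ, ρ_w)`) BEFORE
  `∀ n η (ηL^{n+1} = 1) c₀ c₁ (c₀(L^{n+1})^d = c₁) (|η|^d∕c₀ ≤ ρ_w) m U (E162's data αU hα1 hU1 hreg) S (AvgClosed) (U(b) ∈ S) α (0 ≤ α ≤ α₀) hRS
  (‖U(b) − 1‖ ≤ αη) (‖U(∂p) − 1‖ ≤ αη²)` — NO `εU hεU hUε hεg r`, NO `U(b) ∈ U1` (produced) — then for every slot operator `Δ₁` and `0 ≤ θ ≤ γ₁∕2` with the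
  `N₁`-form defect `‖⟨u, Δ₁v⟩ − ⟨u, Δ^η(U)v⟩‖ ≤ θ·N₁(u)N₁(v)`: (a) `(γ₁∕2)·N₁(x)² ≤ re⟨x, Δ₁_{a,k}(U)x⟩`, (b) `0 < re⟨x, Δ₁_{a,k}(U)x⟩` for `x ≠ 0`,
  (c) `‖G₁y − G₀y‖, ‖curl₁(…)‖, ‖div₁(…)‖ ≤ (2∕γ₁²)·θ·‖y‖` for ANY witnesses `hpos₁ hposU` — the host's (a)(b)(c) VERBATIM.
HONEST SCOPE.  [folklore]; the form letter `θ` stays DISPLAYED (its content for `Δ₁ := π_k†Δ^ηπ_k` is the OWNER's INTENT-7 + the λ-letters, not here); the two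
WINDOWS, E162's data, `hRS`, `ρ_w` and the witnesses stay HYPOTHESES; the fine-bond window is NOT derived from plaquettes (torus holonomies; per cube = the IMS road);
energy currency on the diagonal only, no Neumann series, no operator norm of `Δ′_π`, no decay, NOT the (N)-reading.  «NE9 ⇐ the named binders»; NE9 NOT PRINTED ∕
NOT PROVED; NOT summit progress (cell pub-balaban: row NE9 WALLED ON A MODEL (O-NE9-1; #5 UNRULED); spine PROVED 0/9; rung (B)+1 finite T⁴ — NOT infinite volume,
NOT mass gap, NOT BetaPertH, NOT Clay; HONEST DEPENDENCY: continuum YM on T⁴ ⇐ BetaPertH ∧ nine spine estimates (0/9 proved); BetaPertH ⇐ (D1) ∧ (D4) ∧ CAP+tail;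
G-an2-4 gates asym, D1 and NE2/3/4).  NEW file; nothing modified.  Net new unproved facts: 0.
-/

noncomputable section

open scoped InnerProductSpace ComplexConjugate BigOperators

namespace Literature.MathematicalPhysics.QuantumFieldTheory.Balaban1983to89.B9Eq3130HessianSlotPerturbationTwoWindows

open B4Sect5Torus (TSite)
open B9SectCLatticeCarrier (Bond)
open B11Eq103H1Complex (SiteL2K BondL2K covDerivL2K covDivL2K laplaceALatticeK greenK)
open B9Eq310HessianOperator (adTransportW hessOp covCurlL2K)
open B9Eq310DeltaPrime (plaqHolU)
open B9Eq315QTorus (perCfg cornerSite)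
open B9Eq315QTower (towerP UlevOf)
open B9Eq326OperatorTower (laplaceAk QkW RofUk)
open B7Prop1Explicit (U1 Wcx boxVec)
open B7Prop2Explicit (AvgClosed)
open B9Eq3130HessianSlotPerturbationDiagonal (exists_hessian_slot_perturbation_diagonal)
open B7Eq43AveragedSmallnessLinearFeed (twoWindows_linear_feed)

variable {d : ℕ} (L : ℕ) [NeZero L] (hL : 1 ≤ L) (hL2 : 2 ≤ L)
  {𝔸 : Type*} [NormedRing 𝔸] [NormedAlgebra ℂ 𝔸] [CompleteSpace 𝔸] [NormOneClass 𝔸] [StarRing 𝔸] [NormedStarGroup 𝔸] [StarModule ℂ 𝔸]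
  {W : Type*} [NormedAddCommGroup W] [InnerProductSpace ℂ W] [FiniteDimensional ℂ W] (φ : W ≃ₗ[ℂ] 𝔸)
  {Mφ Mφ' : ℝ} (hMφ : 0 ≤ Mφ) (hMφ' : 0 ≤ Mφ') (hφ : ∀ w, ‖φ w‖ ≤ Mφ * ‖w‖) (hφ' : ∀ X, ‖φ.symm X‖ ≤ Mφ' * ‖X‖)
  {a : ℝ} (ha : 0 < a) (τ : 𝔸 →ₗ[ℂ] ℂ) {Cτ : ℝ} (hτ : ∀ X, ‖τ X‖ ≤ Cτ * ‖X‖) (hCτ : 0 ≤ Cτ) {ρw : ℝ} (hρw : 0 ≤ ρw)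

include hL2 hMφ hMφ' hφ hφ' ha hτ hCτ hρw

/-- **(3.130) IN THE ENERGY CURRENCY, ABSTRACT IN THE HESSIAN SLOT, ON PRINT's CLASS (3.35) — NO PROFILE BINDER**: `∃ α₀ γ₁ > 0` before every binder; for
every `n`, `η` (`ηL^{n+1} = 1`), weights, `m`, background `U` of E162's data valued in an averaging-closed `S`, `0 ≤ α ≤ α₀`, mutually adjoint transporters,
in the two windows `‖U(b) − 1‖ ≤ αη`, `‖U(∂p) − 1‖ ≤ αη²`, every slot operator `Δ₁` with form defect `θ·N₁(u)N₁(v)` against `Δ^η(U)`, `0 ≤ θ ≤ γ₁∕2`: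
(a) `γ₁∕2`-strong coercivity of `Δ₁ + D_UR_kD*_U + Q_k*aQ_k`, (b) its positive definiteness, (c) `G₁ − G₀ = O(θ)` in the flat energy norm with constant `2∕γ₁²`,
for ANY positivity witnesses — the OWNER's `exists_hessian_slot_perturbation_diagonal` at `r = 1∕L`, fed at `β = Kα` by `twoWindows_linear_feed` (the
conclusions do not see `α`, so only the threshold moves). [folklore]
[cite: Balaban1985BackgroundPropagators, (3.130) p.421, (3.120) p.419, (3.122) p.420, Thm 3.11 p.416, (3.35)–(3.37) p.396; Balaban1985Averaging, Prop. 2 (52)–(54) p.26] -/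
theorem exists_hessian_slot_perturbation_twoWindows :
    ∃ α₀ γ₁ : ℝ, 0 < α₀ ∧ 0 < γ₁ ∧ ∀ (n : ℕ) (η : ℝ), η * (L : ℝ) ^ (n + 1) = 1 →
      ∀ (c₀ c₁ : ℝ) [Fact (0 < c₀)] [Fact (0 < c₁)], c₀ * ((L : ℝ) ^ (n + 1)) ^ d = c₁ → |η| ^ d / c₀ ≤ ρw →
      ∀ (m : Fin d → ℕ) [∀ i, NeZero (m i)] (U : Bond d (towerP L m (n + 1)) → 𝔸ˣ) (αU : ℕ → ℝ) (hα1 : ∀ j, αU j ≤ 1 / 64)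
        (hU1 : ∀ (j : ℕ) (x : B7Prop1Explicit.Site d) (κ : Fin d), perCfg (towerP L m (j + 1)) (UlevOf L m (n + 1) U j) x κ ∈ U1 𝔸)
        (hreg : ∀ (j : ℕ) (y : TSite d (towerP L m j)) (κ : Fin d) (r : Fin d → Fin L),
          ‖((Wcx L (perCfg (towerP L m (j + 1)) (UlevOf L m (n + 1) U j)) (cornerSite L y) κ (boxVec L r) : 𝔸ˣ) : 𝔸) - 1‖ ≤ αU j)
        {S : Subgroup 𝔸ˣ}, AvgClosed d L S → (∀ b, U b ∈ S) →
      ∀ {α : ℝ}, 0 ≤ α → α ≤ α₀ →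
        (∀ (b : Bond d (towerP L m (n + 1))) (v u : W), ⟪adTransportW φ U b v, u⟫_ℂ = ⟪v, adTransportW φ (fun b => (U b)⁻¹) b u⟫_ℂ) →
        (∀ b, ‖(U b : 𝔸) - 1‖ ≤ α * η) →
        (∀ p : B9SectCLatticeCarrier.Plaq d (towerP L m (n + 1)), ‖(plaqHolU U p : 𝔸) - 1‖ ≤ α * η ^ 2) →
        ∀ (Δ₁ : BondL2K ℂ d (towerP L m (n + 1)) c₀ W →ₗ[ℂ] BondL2K ℂ d (towerP L m (n + 1)) c₀ W) {θ : ℝ}, 0 ≤ θ → θ ≤ γ₁ / 2 →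
        (∀ u v : BondL2K ℂ d (towerP L m (n + 1)) c₀ W, ‖⟪u, Δ₁ v⟫_ℂ - ⟪u, hessOp φ η U τ v⟫_ℂ‖ ≤
            θ * Real.sqrt (‖covCurlL2K ℂ c₀ ((η : ℂ))⁻¹ (adTransportW φ (fun _ : Bond d (towerP L m (n + 1)) => (1 : 𝔸ˣ))) u‖ ^ 2 +
                  ‖covDivL2K ℂ c₀ ((η : ℂ))⁻¹ (adTransportW φ fun _ : Bond d (towerP L m (n + 1)) => (1 : 𝔸ˣ)⁻¹) u‖ ^ 2 + ‖u‖ ^ 2) *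
                Real.sqrt (‖covCurlL2K ℂ c₀ ((η : ℂ))⁻¹ (adTransportW φ (fun _ : Bond d (towerP L m (n + 1)) => (1 : 𝔸ˣ))) v‖ ^ 2 +
                  ‖covDivL2K ℂ c₀ ((η : ℂ))⁻¹ (adTransportW φ fun _ : Bond d (towerP L m (n + 1)) => (1 : 𝔸ˣ)⁻¹) v‖ ^ 2 + ‖v‖ ^ 2)) →
        -- (a) strong coercivity of the perturbed operator
        (∀ x : BondL2K ℂ d (towerP L m (n + 1)) c₀ W,
          γ₁ / 2 * (‖covCurlL2K ℂ c₀ ((η : ℂ))⁻¹ (adTransportW φ (fun _ : Bond d (towerP L m (n + 1)) => (1 : 𝔸ˣ))) x‖ ^ 2 +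
              ‖covDivL2K ℂ c₀ ((η : ℂ))⁻¹ (adTransportW φ fun _ : Bond d (towerP L m (n + 1)) => (1 : 𝔸ˣ)⁻¹) x‖ ^ 2 + ‖x‖ ^ 2) ≤
            RCLike.re ⟪x, laplaceALatticeK ((η : ℂ))⁻¹ (adTransportW φ U) (adTransportW φ fun b => (U b)⁻¹) Δ₁ (RofUk L m n φ η U)
              (QkW L m n φ U hL αU hα1 hU1 hreg (c₁ := c₁)) a x⟫_ℂ) ∧
        -- (b) positive definiteness
        (∀ x : BondL2K ℂ d (towerP L m (n + 1)) c₀ W, x ≠ 0 →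
          0 < RCLike.re ⟪x, laplaceALatticeK ((η : ℂ))⁻¹ (adTransportW φ U) (adTransportW φ fun b => (U b)⁻¹) Δ₁ (RofUk L m n φ η U)
              (QkW L m n φ U hL αU hα1 hU1 hreg (c₁ := c₁)) a x⟫_ℂ) ∧
        -- (c) the Green's functions differ by `O(θ)` in the flat energy norm
        (∀ (hpos₁ : ∀ x : BondL2K ℂ d (towerP L m (n + 1)) c₀ W, x ≠ 0 →
            0 < RCLike.re ⟪x, laplaceALatticeK ((η : ℂ))⁻¹ (adTransportW φ U) (adTransportW φ fun b => (U b)⁻¹) Δ₁ (RofUk L m n φ η U)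
              (QkW L m n φ U hL αU hα1 hU1 hreg (c₁ := c₁)) a x⟫_ℂ)
          (hposU : ∀ x : BondL2K ℂ d (towerP L m (n + 1)) c₀ W, x ≠ 0 →
            0 < RCLike.re ⟪x, laplaceAk L m n φ η U hL αU hα1 hU1 hreg τ (c₀ := c₀) (c₁ := c₁) a x⟫_ℂ)
          (y : BondL2K ℂ d (towerP L m (n + 1)) c₀ W),
          ‖greenK (laplaceALatticeK ((η : ℂ))⁻¹ (adTransportW φ U) (adTransportW φ fun b => (U b)⁻¹) Δ₁ (RofUk L m n φ η U)
              (QkW L m n φ U hL αU hα1 hU1 hreg (c₁ := c₁)) a) hpos₁ y -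
            greenK (laplaceAk L m n φ η U hL αU hα1 hU1 hreg τ (c₀ := c₀) (c₁ := c₁) a) hposU y‖ ≤ 2 / γ₁ ^ 2 * θ * ‖y‖ ∧
          ‖covCurlL2K ℂ c₀ ((η : ℂ))⁻¹ (adTransportW φ (fun _ : Bond d (towerP L m (n + 1)) => (1 : 𝔸ˣ)))
            (greenK (laplaceALatticeK ((η : ℂ))⁻¹ (adTransportW φ U) (adTransportW φ fun b => (U b)⁻¹) Δ₁ (RofUk L m n φ η U)
              (QkW L m n φ U hL αU hα1 hU1 hreg (c₁ := c₁)) a) hpos₁ y -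
            greenK (laplaceAk L m n φ η U hL αU hα1 hU1 hreg τ (c₀ := c₀) (c₁ := c₁) a) hposU y)‖ ≤ 2 / γ₁ ^ 2 * θ * ‖y‖ ∧
          ‖covDivL2K ℂ c₀ ((η : ℂ))⁻¹ (adTransportW φ fun _ : Bond d (towerP L m (n + 1)) => (1 : 𝔸ˣ)⁻¹)
            (greenK (laplaceALatticeK ((η : ℂ))⁻¹ (adTransportW φ U) (adTransportW φ fun b => (U b)⁻¹) Δ₁ (RofUk L m n φ η U)
              (QkW L m n φ U hL αU hα1 hU1 hreg (c₁ := c₁)) a) hpos₁ y -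
            greenK (laplaceAk L m n φ η U hL αU hα1 hU1 hreg τ (c₀ := c₀) (c₁ := c₁) a) hposU y)‖ ≤ 2 / γ₁ ^ 2 * θ * ‖y‖) := by
  have hL0 : (0 : ℝ) < L := by exact_mod_cast lt_of_lt_of_le (by norm_num) hL2
  have hr0 : (0 : ℝ) ≤ 1 / (L : ℝ) := by positivity
  have hr1 : 1 / (L : ℝ) < 1 := by rw [div_lt_one hL0]; exact_mod_cast lt_of_lt_of_le (by norm_num) hL2
  -- the OWNER's abstract-slot (3.130) at `r = 1∕L`
  obtain ⟨α₁, γ₁, hα₁, hγ₁, H⟩ := exists_hessian_slot_perturbation_diagonal (d := d) L hL φ hMφ hMφ' hφ hφ' ha hr0 hr1 τ hτ hCτ hρw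
  -- the α-linear feed below its threshold
  obtain ⟨T, hT, F⟩ := twoWindows_linear_feed L hL2 (d := d) (𝔸 := 𝔸) hα₁
  refine ⟨T, γ₁, hT, hγ₁, ?_⟩
  intro n η hηL c₀ c₁ _ _ hw hρ m _ U αU hα1 hU1 hreg S hS hU α hα0 hαle hRS hUη hpl Δ₁ θ hθ0 hθle hθ
  obtain ⟨hβ0, hβ1, hUb, hUη', hpl', -, εU, hεU, hUε, hεg⟩ := F m n hS hU hηL hα0 hαle hUη hpl
  exact H n η hηL c₀ c₁ hw hρ m U αU hα1 hU1 hreg εU hεU hUε hβ0 hβ1 hRS hUb hUη' hpl' hεg Δ₁ hθ0 hθle hθ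

end Literature.MathematicalPhysics.QuantumFieldTheory.Balaban1983to89.B9Eq3130HessianSlotPerturbationTwoWindows

end
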